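/-
Copyright (c) 2026 the pub-hodgecm-mathlib formalisation cell (harness21).  Prover seat hodgecm-mathlib-LH4-p16 (g2), req620 Track A «(D-RAM) FOUR-FRAME» squad
(STAGE-1b, row (2) of the piece `f_{T₊}`, the (β₂) road (R-36); β₂ sub-dealer LH4-p04 (g9) «= ROAD K5∕K6», target ‹CORE.letter.v1›; MECH-K3 v1 §2 «label = ω(t′)·ω(α₁ + γ₁V)»:
the MASTER's per-vertex half), 2026-09-05.
-/
import Summits.HodgeConjecture.HodgeConjecture.Theorems.F0P3cDyRamRayScalarNearlyFixed        -- ★ p863048 (this seat): every row vertex is a fixed-unit ray; brings HEAD B, ★ p861653, (S0″)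
import Summits.HodgeConjecture.HodgeConjecture.Theorems.F0P3cDyRamRowVertexAffineCoordinate    -- ★ p862871 (this seat): `rayScalar_eq_affine`
import Summits.HodgeConjecture.HodgeConjecture.Theorems.F0P3cDyRamSmulXPlusLabel              -- ★ (LH4-p13): `labelPlus_smul_xPlus_iff_exists_norm` (the norm-class bit of a fixed-unit ray)
import Literature.NumberTheory.LocalFields.ValuedCompleteIsAdicComplete                      -- ★ BRIDGE-AC (LH4-p02): `isAdicComplete_valuedInteger_of_completeSpace`
import HarnessLib

/-!
# Crux `H413`, line LH4 «(D-RAM) FOUR-FRAME» — STAGE-1b, row (2), the (β₂) road (R-36), (ROW-INT) ∕ ‹CORE›, the MASTER's per-vertex half: «THE LABEL OF A ROW VERTEX IS THE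
# AFFINE SIGN OF ITS DIGIT» — `VS_{m*}(Γ − 1 | L) = VS_{m*}(X₊)` iff `ω(pw·(ϖσϖ)^b)·ω(α₁ + γ₁·V(Λ)) = 1`

Cell `hodgecm-mathlib` (D-0151), FLOOR 0, crux item H413 = `stmt-HodgeConjecture-24833`, route of record `HCCMUnconditional`; squad F0∕P3c∕LH4; lane
`--supports stmt-HodgeConjecture-24833 --as helper` (count-neutral; pays NO tier-0 row).  THEOREMS ONLY (no `def`, no instance, no notation, no `sorry`, default heartbeats);
★-only imports; states NO law; (β₂) stays a HYPOTHESIS.  Frame = ★ p863048's HEAD VERBATIM (HEAD B + ★ p861653's letters + sheet datum + line-model structure + population token +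
three deep tokens) with `E` complete, plus: the `E`-decomposition `μ = jE μ_a + jE μ_b·α`, the glue scalar `pw = ⟨w₀, w₀⟩` (`σ`-fixed, `|pw·(ϖσϖ)^b| = 1`), the COORDINATE of the vertex
(★ p862871: `D₀⁻¹(jE pw)⁻¹ = κ₀ + jE(V)·ξ₀`, `σV = V`, `|V| ≤ 1`, reference scalars `jE R₀ = Tr_ρ(ακ₀)`, `jE γ₀ = ξ₀(α − ρα)`), the row's digit sizes `|μ_a + μ_b R₀| = |ϖ|^{2b + d%2}`,
`|μ_b γ₀| = |ϖ|^{2b + 2g + d%2}` (`1 ≤ g`: NOT the terminal cell), and the ROW's affine-sign dictionary `haff` = the `∀`-clause of ★ p862927 `exists_affineLabel_of_coords_any` at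
`â := (μ_a + μ_b R₀)∕(ϖσϖ)^b`, `bh := μ_b γ₀∕(ϖσϖ)^b` (obtained ONCE per row by the assembler, so that `α₁, γ₁` are row constants).
WHY (MECH-K3 v1 §2 `F0/P3c/LH4/LH4-p16/g2/MECH-K3.v1.LH4p16g2.md`; sub-dealer «= ROAD K5∕K6»).  This is the per-vertex statement the MASTER sums over a cell: by ★ p863048 the vertex's
`ϖ^{m*}`-value set is `valueSetMod σ ϖ m* (e′ • X₊)` for a fixed unit `e′` with `|e₀ − e′t₊| ≤ |ϖ|^{m*}`, `e₀ = pw·(μ_a + μ_b(R₀ + Vγ₀))` (★ p862871 `rayScalar_eq_affine`); by ★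
`labelPlus_smul_xPlus_iff_exists_norm` that value set is `X₊`'s iff `e′ ∈ N(E^×)`; by the dictionary `haff` (★ p862927) `ω(e′) = ω(pw·(ϖσϖ)^b)·ω(α₁ + γ₁V)`.  So: the LABEL of the
vertex is `ω(pw(Λ)·P)·ω(α₁ + γ₁·V(Λ))` — population scalar times the AFFINE SIGN of the digit; on the populated vertices of one literal `ω(pw·P)` is a constant (the glue-unit dictionary),
which leaves the character sum of ★ LH4-p14 over the digits (K6).
WHAT IS NOT CLAIMED: the constancy of `ω(pw·P)` on populated vertices, the digit system, the cell sum, any census identity.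
HONEST LABEL.  Count-neutral valuation ∕ lattice algebra; nothing printed is asserted; no census law is stated; `HC_CM` is proved only modulo the 7 printed citations (2 remaining named
inputs: hLiu418 = `stmt-HodgeConjecture-24832`, h413 = `stmt-HodgeConjecture-24833`) until rung 0 closes.
## References
* [Jacobowitz1962] R. Jacobowitz, *Hermitian forms over local fields*, Amer. J. Math. 84 (1962): §4; [Kottwitz1986BaseChangeUnits] R. E. Kottwitz, Compositio Math. 60 (1986): §1 pp. 240–241.
* [Rogawski1990] J. D. Rogawski, *Automorphic Representations of Unitary Groups in Three Variables*, Ann. of Math. Stud. 123 (1990): §4.9 Prop. 4.9.1 (b) p. 55, §12.2.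
* [Serre1979] J.-P. Serre, *Local Fields*, GTM 67 (1979): Ch. V §3 Cor. 3, Ch. XV §2; [LanglandsShelstad1987] R. P. Langlands, D. Shelstad, Math. Ann. 278 (1987): §1–§3.
-/

set_option autoImplicit false

noncomputable section

namespace Summit.HodgeConjecture.HodgeConjecture.Cruxes.H413.F0P3cDyRamRowVertexAffineSignLabel

open scoped Valued WithZero Matrix MatrixGroups
open WithZero
open Literature.NumberTheory.Automorphic Literature.NumberTheory.Automorphic.HermitianLattice Literature.NumberTheory.Automorphic.UnitaryLatticeTree
open Literature.NumberTheory.Automorphic.UnitaryThreeFourFrame (IsRamifiedQuadraticDatum normSign)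
open Literature.NumberTheory.Rogawski1990
open Literature.NumberTheory.LocalFields (isAdicComplete_valuedInteger_of_completeSpace)
open Summit.HodgeConjecture.HodgeConjecture.Cruxes.H413.F0P3cDyRamFourFramePieces
open Summit.HodgeConjecture.HodgeConjecture.Cruxes.H413.F0P3cDyRamToricCensusDefs
open Summit.HodgeConjecture.HodgeConjecture.Cruxes.H413.F0P3cDyRamDiagonalCellLetter (inv_add_map_inv_eq_map_pairing)
open Summit.HodgeConjecture.HodgeConjecture.Cruxes.H413.F0P3cDyRamRayScalarNearlyFixed (exists_fixed_unit_valueSet_endoGL_sub_one_glued_eq_smul_xPlus)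
open Summit.HodgeConjecture.HodgeConjecture.Cruxes.H413.F0P3cDyRamRowVertexAffineCoordinate (rayScalar_eq_affine)
open Summit.HodgeConjecture.HodgeConjecture.Cruxes.H413.F0P3cDyRamSmulXPlusLabel (labelPlus_smul_xPlus_iff_exists_norm)

variable {E M : Type} [Field E] [Valued E ℤᵐ⁰] [Field M] [Valued M ℤᵐ⁰] {ρ Θ : M →+* M} {α : M}

/-- **HEAD — «THE LABEL OF A ROW VERTEX IS THE AFFINE SIGN OF ITS DIGIT».**  ★ p863048's frame (`E` complete) + the vertex's coordinate (★ p862871) + the row's digit sizes + the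
row's affine-sign dictionary (★ p862927's `∀`-clause, `α₁, γ₁` row constants) ⟹ the `ϖ^{m*}`-value set of `Γ − 1` on the glued vertex `L` equals that of `X₊` IFF
`ω(pw·(ϖσϖ)^b)·ω(α₁ + γ₁·V) = 1` (`ω = normSign σ`, `pw = ⟨w₀, w₀⟩`, `V = V(Λ)`). [cite: Rogawski1990, §4.9 Prop. 4.9.1 (b) p. 55] [cite: Kottwitz1986BaseChangeUnits, §1 pp. 240–241]
[cite: Jacobowitz1962, §4] [cite: Serre1979, Ch. V §3 Cor. 3; Ch. XV §2] [cite: LanglandsShelstad1987, §1–§3] -/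
theorem valueSet_rowVertex_eq_xPlus_iff_affineSign [CompleteSpace E] {σ : E →+* E} {ϖ : E} {d t : ℕ} (hD : IsRamifiedQuadraticDatum σ ϖ d t)
    (H₂ : Matrix (Fin 2) (Fin 2) E) (h : E)
    (jE : E →+* M) (hjv : ∀ c, Valued.v (jE c) ≤ 1 ↔ Valued.v c ≤ 1) (hjfix : ∀ z, ρ z = z ↔ ∃ c, jE c = z)
    (hρρ : ∀ x, ρ (ρ x) = x) (hvρ : ∀ x, Valued.v (ρ x) = Valued.v x) (hα : ρ α ≠ α) (hα1 : Valued.v α ≤ 1)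
    (hintρ : ∀ z : M, Valued.v z ≤ 1 → Valued.v ((z - ρ z) / (α - ρ α)) ≤ 1)
    (hΘΘ : ∀ x, Θ (Θ x) = x) (hΘρ : ∀ x, Θ (ρ x) = ρ (Θ x)) (hvΘ : ∀ x, Valued.v (Θ x) = Valued.v x) (hΘj : ∀ c, Θ (jE c) = jE (σ c))
    (φ : (Fin 2 → E) →+ M) (hφs : ∀ (c : E) (x : Fin 2 → E), φ (c • x) = jE c * φ x)
    {γ₂ : GL (Fin 2) E} {lam hM : M} (hφγ : ∀ x, φ ((γ₂ : Matrix (Fin 2) (Fin 2) E) *ᵥ x) = lam * φ x) (hhM : hM ≠ 0) (hΘh : Θ hM = hM)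
    (hform : ∀ x y, jE (pairing σ H₂ x y) = hM * Θ (φ x) * φ y + ρ (hM * Θ (φ x) * φ y))
    {L : Submodule 𝒪[E] (Fin 3 → E)} {b : ℕ} (hpr : ∀ x ∈ L, Valued.v (x 1) * Valued.v ϖ ^ b ≤ 1)
    (hint : ∀ y ∈ L, Valued.v (pairing σ (!![H₂ 0 0, 0, H₂ 0 1; 0, h, 0; H₂ 1 0, 0, H₂ 1 1] : Matrix (Fin 3) (Fin 3) E) y y) ≤ 1)
    {B₂ : Submodule 𝒪[E] (Fin 2 → E)} {w₀ : Fin 2 → E} {g₀ : Fin 3 → E}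
    (hB : B₂.map ((Matrix.toLin' (!![1, 0; 0, 0; 0, 1] : Matrix (Fin 3) (Fin 2) E)).restrictScalars 𝒪[E]) =
      L ⊓ LinearMap.ker ((LinearMap.proj (1 : Fin 3) : (Fin 3 → E) →ₗ[E] E).restrictScalars 𝒪[E]))
    (hg₀ : g₀ ∈ L) (hg₀1 : Valued.v (g₀ 1) * Valued.v ϖ ^ b = 1) (hprg : g₀ - Pi.single 1 (g₀ 1) = ![w₀ 0, 0, w₀ 1])
    (u : GL (Fin 1) E)
    {cc x₀ : M} (hc : ρ cc = cc) (hc0 : cc ≠ 0) (hc1 : Valued.v cc ≤ 1) (hcc : cc * (α - ρ α) ≠ 0) (hx₀ : x₀ ≠ 0)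
    {Λ : AddSubgroup M} (hBΛ : B₂.toAddSubgroup.map φ = Λ)
    (hΛx : ∀ x, x ∈ Λ ↔ ∃ ζ, IsOrd ρ α cc ζ ∧ x = x₀ * ζ) (hw₀Y : φ w₀ = (dualGen ρ Θ α cc hM x₀)⁻¹ * x₀)
    -- the ray-domination letters (★ p861653) at the modulus `m*`
    (hYO : IsOrd ρ α cc (dualGen ρ Θ α cc hM x₀))
    {μt : M} {m' : ℕ} (hμ : lam - jE ((u : Matrix (Fin 1) (Fin 1) E) 0 0) = jE (ϖ ^ m') * μt) (hμt : IsOrd ρ α cc μt) (hmm : mstarOfRecord d ≤ m')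
    -- the line-model structure, the population token, the ray scalar on the `ℓ₀`-shell, the three deep tokens
    (hΘlam : Θ lam * lam = 1) (hvlam : Valued.v lam = 1)
    (huu : ((u : Matrix (Fin 1) (Fin 1) E) 0 0) * σ ((u : Matrix (Fin 1) (Fin 1) E) 0 0) = 1)
    (hP : IsOrd ρ α cc ((lam - jE ((u : Matrix (Fin 1) (Fin 1) E) 0 0)) / dualGen ρ Θ α cc hM x₀))
    {n : ℕ} (hn : 3 * d - 2 + d % 2 ≤ n)
    (hlamn : Valued.v (lam - 1) ≤ Valued.v (jE ϖ) ^ n) (hun : Valued.v ((u : Matrix (Fin 1) (Fin 1) E) 0 0 - 1) ≤ Valued.v ϖ ^ n)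
    (hsk : Valued.v ((lam - jE ((u : Matrix (Fin 1) (Fin 1) E) 0 0)) / dualGen ρ Θ α cc hM x₀) * Valued.v (lam - ρ lam) ≤
      Valued.v (jE ϖ) ^ n * Valued.v (cc * (α - ρ α)))
    -- the `E`-decomposition of the depth multiplier, the glue scalar, the coordinate of the vertex and the affine-sign dictionary of the row
    {μa μb : E} (hμab : lam - jE ((u : Matrix (Fin 1) (Fin 1) E) 0 0) = jE μa + jE μb * α)
    (hσpw : σ (pairing σ H₂ w₀ w₀) = pairing σ H₂ w₀ w₀) (hpwv : Valued.v (pairing σ H₂ w₀ w₀ * (ϖ * σ ϖ) ^ b) = 1)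
    {κ₀ ξ₀ : M} (hξ : ρ ξ₀ = -ξ₀) {V : E} (hσV : σ V = V) (hV1 : Valued.v V ≤ 1)
    (hκ : (cc * (α - ρ α) * Θ (dualGen ρ Θ α cc hM x₀))⁻¹ * (jE (pairing σ H₂ w₀ w₀))⁻¹ = κ₀ + jE V * ξ₀)
    {R₀ γ₀ : E} (hR₀ : jE R₀ = α * κ₀ + ρ (α * κ₀)) (hγ₀ : jE γ₀ = ξ₀ * (α - ρ α))
    {g : ℕ} (hg1 : 1 ≤ g) (hâ : Valued.v (μa + μb * R₀) = Valued.v ϖ ^ (2 * b + d % 2)) (hbh : Valued.v (μb * γ₀) = Valued.v ϖ ^ (2 * b + (2 * g + d % 2)))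
    {α₁ γ₁ : E}
    (haff : ∀ (T W f : E), σ T = T → Valued.v T = 1 → σ W = W → Valued.v W ≤ 1 → σ f = f →
      Valued.v (T * ((μa + μb * R₀) * ((ϖ * σ ϖ) ^ b)⁻¹ + μb * γ₀ * ((ϖ * σ ϖ) ^ b)⁻¹ * W) - f * ((ϖ - σ ϖ) * ((ϖ * σ ϖ) ^ ((d - d % 2) / 2))⁻¹)) ≤
        Valued.v ϖ ^ mstarOfRecord d → normSign σ f = normSign σ T * normSign σ (α₁ + γ₁ * W)) :
    ({z : E | ∃ y ∈ L, Valued.v ((ϖ ^ mstarOfRecord d)⁻¹ * (z - pairing σ (!![H₂ 0 0, 0, H₂ 0 1; 0, h, 0; H₂ 1 0, 0, H₂ 1 1] : Matrix (Fin 3) (Fin 3) E) y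
          ((((endoGL (γ₂, u) : GL (Fin 3) E) : Matrix (Fin 3) (Fin 3) E) - 1) *ᵥ y))) ≤ 1} =
        valueSetMod σ ϖ (mstarOfRecord d) (xPlus σ ϖ d)) ↔
      normSign σ (pairing σ H₂ w₀ w₀ * (ϖ * σ ϖ) ^ b) * normSign σ (α₁ + γ₁ * V) = 1 := by
  classical
  obtain ⟨hσσ, hvσ, hϖ, -, hd, hd1, -⟩ := id hD
  haveI := isAdicComplete_valuedInteger_of_completeSpace (K := E) hϖ
  have hvϖ0 : Valued.v ϖ ≠ 0 := by rw [hϖ]; exact exp_ne_zero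
  have hϖ0 : ϖ ≠ 0 := fun h0 => by rw [h0, map_zero] at hvϖ0; exact hvϖ0 rfl
  have hϖlt : Valued.v ϖ < 1 := by rw [hϖ, ← exp_zero, exp_lt_exp]; norm_num
  have hρj : ∀ c : E, ρ (jE c) = jE c := fun c => (hjfix _).2 ⟨c, rfl⟩
  set D₀ : M := cc * (α - ρ α) * Θ (dualGen ρ Θ α cc hM x₀) with hD₀def
  set pw : E := pairing σ H₂ w₀ w₀ with hpwdef
  set P : E := (ϖ * σ ϖ) ^ b with hPdef
  set tp : E := (ϖ - σ ϖ) * ((ϖ * σ ϖ) ^ ((d - d % 2) / 2))⁻¹ with htpdef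
  -- the glue letter and the ray scalar `e₀ = pw·(μ_a + μ_b(R₀ + Vγ₀))`
  have hTr : D₀⁻¹ + ρ D₀⁻¹ = jE pw := inv_add_map_inv_eq_map_pairing σ H₂ jE hΘΘ φ hhM hform hcc hx₀ hw₀Y
  have hP0 : P ≠ 0 := pow_ne_zero _ (mul_ne_zero hϖ0 ((map_ne_zero σ).2 hϖ0))
  have hPv : Valued.v P = Valued.v ϖ ^ (2 * b) := by rw [hPdef, Valuation.map_pow, Valuation.map_mul, hvσ, ← pow_two, ← pow_mul, mul_comm]
  have hpw0 : pw ≠ 0 := fun h0 => by rw [h0, zero_mul, Valuation.map_zero] at hpwv; exact zero_ne_one hpwv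
  set e₀ : E := pw * (μa + μb * (R₀ + V * γ₀)) with he₀def
  have he₀ : jE e₀ = (lam - jE ((u : Matrix (Fin 1) (Fin 1) E) 0 0)) / D₀ + ρ ((lam - jE ((u : Matrix (Fin 1) (Fin 1) E) 0 0)) / D₀) := by
    rw [hμab, he₀def]; exact (rayScalar_eq_affine (α := α) jE hρj hρρ hTr hpw0 hξ (by rw [hρj]) hκ hR₀ hγ₀ μa μb).symm
  -- `|e₀| = |ϖ|^{d%2}`: the digit term is strictly below the main term (`g ≥ 1`, `|V| ≤ 1`)
  have hmain : Valued.v (μa + μb * (R₀ + V * γ₀)) = Valued.v ϖ ^ (2 * b + d % 2) := by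
    have e : μa + μb * (R₀ + V * γ₀) = (μa + μb * R₀) + μb * γ₀ * V := by ring
    have hlt : Valued.v (μb * γ₀ * V) < Valued.v (μa + μb * R₀) := by
      rw [hâ, Valuation.map_mul, hbh]
      calc Valued.v ϖ ^ (2 * b + (2 * g + d % 2)) * Valued.v V ≤ Valued.v ϖ ^ (2 * b + (2 * g + d % 2)) * 1 := mul_le_mul' le_rfl hV1
        _ < Valued.v ϖ ^ (2 * b + d % 2) := by rw [mul_one]; exact pow_lt_pow_right_of_lt_one₀ (zero_lt_iff.2 hvϖ0) hϖlt (by omega)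
    rw [e, Valuation.map_add_eq_of_lt_left _ hlt, hâ]
  have he₀v : Valued.v e₀ = Valued.v ϖ ^ (d % 2) := by
    have h1 : Valued.v e₀ * Valued.v ϖ ^ (2 * b) = Valued.v ϖ ^ (d % 2) * Valued.v ϖ ^ (2 * b) := by
      rw [he₀def, Valuation.map_mul, hmain, ← hPv, mul_right_comm, ← Valuation.map_mul, hpwv, one_mul, hPv, ← pow_add, add_comm]
    exact mul_right_cancel₀ (pow_ne_zero _ hvϖ0) h1
  -- ★ p863048: the vertex is the fixed-unit ray `e′ • X₊`
  obtain ⟨e', he'σ, he'1, hclose, hVS⟩ := exists_fixed_unit_valueSet_endoGL_sub_one_glued_eq_smul_xPlus hD H₂ h jE hjv hjfix hρρ hvρ hα hα1 hintρ hΘΘ hΘρ hvΘ hΘj φ hφs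
    hφγ hhM hΘh hform hpr hint hB hg₀ hg₀1 hprg u hc hc0 hc1 hcc hx₀ hBΛ hΛx hw₀Y hYO hμ hμt hmm hΘlam hvlam huu hP he₀ he₀v hn hlamn hun hsk
  rw [hVS]
  -- ★ the bit of a fixed-unit ray
  have hbit : valueSetMod σ ϖ (mstarOfRecord d) (e' • xPlus σ ϖ d) = valueSetMod σ ϖ (mstarOfRecord d) (xPlus σ ϖ d) ↔ ∃ z : E, z * σ z = e' :=
    labelPlus_smul_xPlus_iff_exists_norm hD he'σ he'1
  rw [hbit]
  -- the affine-sign dictionary at `T := pw·P`, `f := e′`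
  have hσT : σ (pw * P) = pw * P := by rw [map_mul, hσpw, hPdef, map_pow, map_mul, hσσ, mul_comm (σ ϖ) ϖ]
  have hcong : Valued.v (pw * P * ((μa + μb * R₀) * P⁻¹ + μb * γ₀ * P⁻¹ * V) - e' * tp) ≤ Valued.v ϖ ^ mstarOfRecord d := by
    have e : pw * P * ((μa + μb * R₀) * P⁻¹ + μb * γ₀ * P⁻¹ * V) = e₀ := by rw [he₀def]; field_simp; ring
    rw [e]; exact hclose
  have hns := haff (pw * P) V e' hσT hpwv hσV hV1 he'σ hcong
  constructor
  · intro hz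
    have h1 : normSign σ e' = 1 := by rw [normSign, if_pos hz]
    rw [← h1, hns]
  · intro h1
    rw [← hns] at h1
    by_contra hz
    rw [normSign, if_neg hz] at h1
    exact absurd h1 (by norm_num)

end Summit.HodgeConjecture.HodgeConjecture.Cruxes.H413.F0P3cDyRamRowVertexAffineSignLabel

end
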